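import Literature.MathematicalPhysics.QuantumFieldTheory.Balaban1983to89.B7Prop3GeneralAnalytic
import Summits.QuantumFields.BalabanUV.Beta.LinearizingChange267FromQ

/-!
# [B7] Proposition 3 at a general background: the second-order remainder (123) by the Cauchy estimate along the ray

Row S55 (analytic∕remainder half) of the pub-balaban NE7c crew table.  Print ([Balaban1985Averaging] = T. Bałaban,
Comm. Math. Phys. 98 (1985), Prop. 3 p. 36): "Q(V₀, A, c) = L(Q(V₀)A)_c + C(V₀, A, c). (122)  C(V₀, A, c) is an analytic
function of A whose Taylor's expansion begins with a second-order polynomial (a quadratic form), and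
|C(V₀, A, c)| ≦ C₁L²|A|² < C₁(Lα₁)². (123)" … "The constant C₁ depends on d and c₃ depends on d and L."

WHAT THIS FILE PROVES, on the b07-lineage objects (`B7Eq92Concrete.dbavgCov`, `B7Prop3Flat.expCfg`, `MatrixLog.mlog`;
`Q(V₀, A, c)` is `mlog (dbavgCov L V₀ (expCfg A) q κ)` up to the unit `1/i`, = `B7Prop3GeneralLinear.Qcov L V₀ A q κ` of the
linear half by `rfl`; the first-order term «L(Q(V₀)A)_c» is the `t`-derivative at `0` of `t ↦ Q(V₀, tA, c)`,
= `B7Prop3GeneralLinear.linQcov` by `rfl`):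
* `mlog_dbavgCov_expCfg_zero` — `Q(V₀, 0, c) = 0` ((120): every factor of `V̿₁(c)` is `1` at `V₁ = 1`).
* `analyticAt_ray`, `norm_ray_le` — along the complex ray `t ↦ Q(V₀, tA, c)`: analytic and bounded by `4` on the disc
  `|t|·sup|A_b| ≤ c₃(d, L)` (the Literature file `B7Prop3GeneralAnalytic`: `prop3_general_analyticAt_of_le_c3`,
  `norm_mlog_dbavgCov_le`).
* **`prop3_general_remainder`** — (123): `‖Q(V₀, A, c) − L(Q(V₀)A)_c‖ ≤ (8 / c₃(d,L)²)·a²` for `sup_b |A_b| ≤ a < c₃(d, L)`,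
  by the ONE-VARIABLE Cauchy estimate for the second-order Taylor remainder of the ray function on the disc of radius
  `c₃/a > 1` (row D4's `LinearizingChange267FromQ.nonlin_sq_bound`), so no chart of the infinite lattice is needed;
  `prop3_general_remainder_explicit`: `8 / c₃² = 131072·(d+1)²·L²` — print's «C₁L²» with `C₁ = C₁(d)`.
* `ray_deriv_add`, `ray_deriv_smul` — the first-order term is additive and homogeneous in `A` (two-parameter analyticity at
  the origin, where no smallness is needed).

DISPLAYED BINDERS (honest): `V₀` unit-bounded (`∀ b, V₀ b ∈ U1`), its block contours at the `L`-bond `c = (q, κ)` `α`-regular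
with `α ≤ 1/64` (print's regular class (43)–(44); from plaquette regularity this is [B7] Prop. 1, not re-derived), `1 ≤ L`.
This is ONE clause of ONE printed proposition on a finite `T⁴` programme's way: «NE7c ⇐ the named binders»; NE7c itself is
NOT printed and NOT proved here.

HONEST FRAMING (cell, verbatim): rung (B)+1 on a FINITE `T⁴` — NOT infinite volume, NOT mass gap, NOT Clay; NE7c NOT
PRINTED, NOT PROVED; spine PROVED 0/9.  HONEST DEPENDENCY: continuum YM on T⁴ ⇐ BetaPertH ∧ nine spine estimates (0/9
proved); BetaPertH ⇐ (D1) ∧ (D4) ∧ CAP+tail; G-an2-4 gates asym, D1 and NE2/3/4.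

v1.1 (DOCFIX, docstrings only; declarations byte-identical): print's (123) sentence quoted in full (XREAD C-ne7cleaf07-14),
the cell's HONEST sentences added (XREAD C-ne7cleaf09-39).
-/

noncomputable section

open scoped BigOperators
open NormedSpace Metric

namespace Summit.QuantumFields.BalabanUV.T4Continuum.ShellMeasureAverageProp3Remainder

open Literature.MathematicalPhysics.QuantumFieldTheory.Balaban1983to89
open B7Prop1Explicit B7Prop3Flat B7Eq92Concrete MatrixLog B7Prop3GeneralAnalytic
open Summit.QuantumFields.BalabanUV.Beta.LinearizingChange267FromQ (nonlin nonlin_sq_bound)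

variable {d : ℕ}
variable {𝔸 : Type*} [NormedRing 𝔸] [NormedAlgebra ℂ 𝔸] [CompleteSpace 𝔸]

/-! ## §1 `Q(V₀, 0, c) = 0` -/

/-- `e^{0} = 1` bondwise. [folklore] -/
theorem expCfg_zero_eq_one : expCfg (0 : B7Prop1Explicit.Site d → Fin d → 𝔸) = 1 := by
  funext x κ
  exact Units.ext (by simp [expCfg])

section One

variable {G : Type*} [Group G]

/-- `(R_{0,y}1)(Γ) = 1`. [folklore] -/
theorem tHol_one_right (V₀ : B7Prop1Explicit.Site d → Fin d → G) (y : B7Prop1Explicit.Site d) (w : List (Letter d)) :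
    tHol V₀ 1 y w = 1 := by
  simp [tHol, one_mul]

end One

omit [CompleteSpace 𝔸] in
/-- `F(y) = 0` at `V₁ = 1`. [folklore] -/
theorem Fcov_one_right (L : ℕ) (V₀ : B7Prop1Explicit.Site d → Fin d → 𝔸ˣ) (y : B7Prop1Explicit.Site d) :
    Fcov L V₀ 1 y = 0 := by
  simp [Fcov, tHol_one_right]

/-- the frame is `1` at `V₁ = 1`. [folklore] -/
theorem wframe_one_right (L : ℕ) (V₀ : B7Prop1Explicit.Site d → Fin d → 𝔸ˣ) (y : B7Prop1Explicit.Site d) :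
    wframe L V₀ 1 y = 1 := by
  refine Units.ext ?_
  rw [wframe, val_expUnit, Fcov_one_right, exp_zero, Units.val_one]

/-- `Ṽ₁ = 1` at `V₁ = 1`. [folklore] -/
theorem tild_one_right (L : ℕ) (V₀ : B7Prop1Explicit.Site d → Fin d → 𝔸ˣ) (q : B7Prop1Explicit.Site d) (κ : Fin d) :
    tild L V₀ 1 q κ = 1 := by
  simp [tild_apply, one_mul]

/-- `V̿₁(c) = 1` at `V₁ = 1` ((89) with all factors `1`). [folklore] -/
theorem dbavgCov_one_right (L : ℕ) (V₀ : B7Prop1Explicit.Site d → Fin d → 𝔸ˣ) (q : B7Prop1Explicit.Site d)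
    (κ : Fin d) : dbavgCov L V₀ 1 q κ = 1 := by
  rw [dbavgCov_apply, wframe_one_right, wframe_one_right, tild_one_right, inv_one, one_mul, one_mul, map_one]

/-- **(120)⇒(121) at `A = 0`**: `Q(V₀, 0, c) = log V̿₁(c)[V₁ = 1] = 0`. [folklore] -/
theorem mlog_dbavgCov_expCfg_zero (L : ℕ) (V₀ : B7Prop1Explicit.Site d → Fin d → 𝔸ˣ) (q : B7Prop1Explicit.Site d)
    (κ : Fin d) : mlog ((dbavgCov L V₀ (expCfg (0 : B7Prop1Explicit.Site d → Fin d → 𝔸)) q κ : 𝔸ˣ) : 𝔸) = 0 := by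
  rw [expCfg_zero_eq_one, dbavgCov_one_right, Units.val_one, mlog_one]

/-! ## §2 The ray function `t ↦ Q(V₀, tA, c)`: analytic and bounded on the disc `|t|·a ≤ c₃` -/

section Ray

variable [NormOneClass 𝔸]

/-- print's threshold in the `θ`-currency of `B7Prop3GeneralAnalytic`: `a ≤ c₃(d, L) = 1/(128(d+1)L)` gives
`(2d+2)L·a ≤ 1/64`. [folklore] -/
theorem theta_le_of_le_c3 {L : ℕ} (hL : 1 ≤ L) {a : ℝ} (hac : a ≤ c3 d L) :
    ((2 * (d * L) + L + L : ℕ) : ℝ) * a ≤ 1 / 64 := by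
  have hL1 : (1 : ℝ) ≤ L := by exact_mod_cast hL
  have hcast : ((2 * (d * L) + L + L : ℕ) : ℝ) = 2 * ((d : ℝ) + 1) * L := by push_cast; ring
  rw [hcast]
  have hpos : (0 : ℝ) < 128 * ((d : ℝ) + 1) * L := by positivity
  have h1 : a * (128 * ((d : ℝ) + 1) * L) ≤ 1 := by
    have := mul_le_mul_of_nonneg_right hac hpos.le
    rwa [c3, one_div, inv_mul_cancel₀ hpos.ne'] at this
  nlinarith

/-- Along the complex ray: `t ↦ Q(V₀, tA, c)` is analytic at every `t₀` with `|t₀|·sup_b|A_b| ≤ c₃(d, L)`. [folklore] -/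
theorem analyticAt_ray {L : ℕ} (hL : 1 ≤ L) {V₀ : B7Prop1Explicit.Site d → Fin d → 𝔸ˣ}
    (hV₀ : ∀ x κ, V₀ x κ ∈ U1 𝔸) (A : B7Prop1Explicit.Site d → Fin d → 𝔸) {a α : ℝ} (ha : 0 ≤ a)
    (hA : ∀ x κ, ‖A x κ‖ ≤ a) (q : B7Prop1Explicit.Site d) (κ : Fin d) (hα1 : α ≤ 1 / 64)
    (hreg : ∀ r : Fin d → Fin L, ‖((Wcx L V₀ q κ (boxVec L r) : 𝔸ˣ) : 𝔸) - 1‖ ≤ α)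
    {t₀ : ℂ} (ht : ‖t₀‖ * a ≤ c3 d L) :
    AnalyticAt ℂ (fun t : ℂ => mlog ((dbavgCov L V₀ (expCfg (t • A)) q κ : 𝔸ˣ) : 𝔸)) t₀ :=
  prop3_general_analyticAt_of_le_c3 (fun t : ℂ => t • A)
    (fun x κ' => by simp only [Pi.smul_apply]; exact analyticAt_id.smul analyticAt_const)
    hL hV₀ (by positivity) (fun x κ' => by
      rw [Pi.smul_apply, Pi.smul_apply, norm_smul]; exact mul_le_mul_of_nonneg_left (hA x κ') (norm_nonneg _))
    ht q κ hα1 hreg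

/-- … and bounded by `4` there. [folklore] -/
theorem norm_ray_le {L : ℕ} (hL : 1 ≤ L) {V₀ : B7Prop1Explicit.Site d → Fin d → 𝔸ˣ}
    (hV₀ : ∀ x κ, V₀ x κ ∈ U1 𝔸) (A : B7Prop1Explicit.Site d → Fin d → 𝔸) {a α : ℝ} (ha : 0 ≤ a)
    (hA : ∀ x κ, ‖A x κ‖ ≤ a) (q : B7Prop1Explicit.Site d) (κ : Fin d) (hα1 : α ≤ 1 / 64)
    (hreg : ∀ r : Fin d → Fin L, ‖((Wcx L V₀ q κ (boxVec L r) : 𝔸ˣ) : 𝔸) - 1‖ ≤ α)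
    {t₀ : ℂ} (ht : ‖t₀‖ * a ≤ c3 d L) :
    ‖mlog ((dbavgCov L V₀ (expCfg (t₀ • A)) q κ : 𝔸ˣ) : 𝔸)‖ ≤ 4 :=
  norm_mlog_dbavgCov_le hL hV₀ (t₀ • A) (a := ‖t₀‖ * a) (by positivity)
    (fun x κ' => by
      rw [Pi.smul_apply, Pi.smul_apply, norm_smul]; exact mul_le_mul_of_nonneg_left (hA x κ') (norm_nonneg _))
    le_rfl (by positivity) (theta_le_of_le_c3 hL ht) q κ hα1 hreg

/-! ## §3 (123): the second-order remainder by the Cauchy estimate along the ray -/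

/-- **[B7] PROPOSITION 3, (123) AT A GENERAL BACKGROUND**: "C(V₀, A, c) is an analytic function of A whose Taylor's
expansion begins with a second-order polynomial (a quadratic form), and |C(V₀, A, c)| ≦ C₁L²|A|² < C₁(Lα₁)²" (print's
`|A| < α₁`; the word «hence» below is this file's proof logic, not print's) — for `V₀` unit-bounded with
`α`-regular block contours at `c` (`α ≤ 1/64`) and `sup_b |A_b| ≤ a`, `0 < a < c₃(d, L)`:
`‖Q(V₀, A, c) − L(Q(V₀)A)_c‖ ≤ (8 / c₃(d,L)²)·a²`, where `Q(V₀, A, c) = log V̿₁(c)[e^{A}]` and «L(Q(V₀)A)_c» is the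
`t`-derivative at `0` of `t ↦ Q(V₀, tA, c)` (the first-order Taylor term; `B7Prop3GeneralLinear.linQcov`).  Proof: the ray
function is analytic and bounded by `4` on the disc `|t| < c₃/a`, vanishes at `0`, and the Cauchy estimate bounds its
second-order remainder at `t = 1` by `2·4/(c₃/a)²`. [cite: Balaban1985Averaging, Proposition 3 (123) p.36] -/
theorem prop3_general_remainder {L : ℕ} (hL : 1 ≤ L) {V₀ : B7Prop1Explicit.Site d → Fin d → 𝔸ˣ}
    (hV₀ : ∀ x κ, V₀ x κ ∈ U1 𝔸) (A : B7Prop1Explicit.Site d → Fin d → 𝔸) {a α : ℝ} (ha : 0 < a)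
    (hA : ∀ x κ, ‖A x κ‖ ≤ a) (hac : a < c3 d L) (q : B7Prop1Explicit.Site d) (κ : Fin d) (hα1 : α ≤ 1 / 64)
    (hreg : ∀ r : Fin d → Fin L, ‖((Wcx L V₀ q κ (boxVec L r) : 𝔸ˣ) : 𝔸) - 1‖ ≤ α) :
    ‖mlog ((dbavgCov L V₀ (expCfg A) q κ : 𝔸ˣ) : 𝔸)
        - deriv (fun t : ℂ => mlog ((dbavgCov L V₀ (expCfg (t • A)) q κ : 𝔸ˣ) : 𝔸)) 0‖
      ≤ 8 / (c3 d L) ^ 2 * a ^ 2 := by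
  set g : ℂ → 𝔸 := fun t : ℂ => mlog ((dbavgCov L V₀ (expCfg (t • A)) q κ : 𝔸ˣ) : 𝔸) with hg
  set R : ℝ := c3 d L / a with hR
  have hR1 : 1 < R := by rw [hR, lt_div_iff₀ ha]; linarith
  have hR0 : 0 < R := by linarith
  have hdisc : ∀ t ∈ ball (0 : ℂ) R, ‖t‖ * a ≤ c3 d L := fun t ht => by
    have h := mem_ball_zero_iff.1 ht
    rw [hR, lt_div_iff₀ ha] at h
    exact h.le
  have hDiff : DifferentiableOn ℂ g (ball 0 R) := fun t ht =>
    (analyticAt_ray hL hV₀ A ha.le hA q κ hα1 hreg (hdisc t ht)).differentiableAt.differentiableWithinAt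
  have hM : ∀ t ∈ ball (0 : ℂ) R, ‖g t‖ ≤ 4 := fun t ht => norm_ray_le hL hV₀ A ha.le hA q κ hα1 hreg (hdisc t ht)
  have h0 : g 0 = 0 := by simp only [hg, zero_smul]; exact mlog_dbavgCov_expCfg_zero L V₀ q κ
  have h1 : (1 : ℂ) ∈ ball (0 : ℂ) R := by rw [mem_ball_zero_iff, norm_one]; exact hR1
  have h := nonlin_sq_bound hR0 hDiff hM h0 1 h1
  have hn : nonlin g 1 = g 1 - deriv g 0 := by
    rw [nonlin, ← fderiv_apply_one_eq_deriv]
  rw [hn, norm_one, one_pow, mul_one] at h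
  have hg1 : g 1 = mlog ((dbavgCov L V₀ (expCfg A) q κ : 𝔸ˣ) : 𝔸) := by simp only [hg, one_smul]
  rw [hg1] at h
  refine h.trans (le_of_eq ?_)
  have ha' : a ≠ 0 := ha.ne'
  have hc : c3 d L ≠ 0 := (ha.trans hac).ne'
  rw [hR, div_pow]
  field_simp
  ring

/-- print's constant made explicit: `8 / c₃(d, L)² = 131072·(d+1)²·L²` — «C₁L²» with `C₁ = 131072(d+1)²` depending on `d`
only. [cite: Balaban1985Averaging, Proposition 3 (123) p.36] -/
theorem prop3_general_remainder_explicit {L : ℕ} (hL : 1 ≤ L) {V₀ : B7Prop1Explicit.Site d → Fin d → 𝔸ˣ}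
    (hV₀ : ∀ x κ, V₀ x κ ∈ U1 𝔸) (A : B7Prop1Explicit.Site d → Fin d → 𝔸) {a α : ℝ} (ha : 0 < a)
    (hA : ∀ x κ, ‖A x κ‖ ≤ a) (hac : a < c3 d L) (q : B7Prop1Explicit.Site d) (κ : Fin d) (hα1 : α ≤ 1 / 64)
    (hreg : ∀ r : Fin d → Fin L, ‖((Wcx L V₀ q κ (boxVec L r) : 𝔸ˣ) : 𝔸) - 1‖ ≤ α) :
    ‖mlog ((dbavgCov L V₀ (expCfg A) q κ : 𝔸ˣ) : 𝔸)
        - deriv (fun t : ℂ => mlog ((dbavgCov L V₀ (expCfg (t • A)) q κ : 𝔸ˣ) : 𝔸)) 0‖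
      ≤ 131072 * ((d : ℝ) + 1) ^ 2 * (L : ℝ) ^ 2 * a ^ 2 := by
  refine (prop3_general_remainder hL hV₀ A ha hA hac q κ hα1 hreg).trans (le_of_eq ?_)
  have hL0 : (0 : ℝ) < L := by exact_mod_cast hL
  have hpos : (0 : ℝ) < 128 * ((d : ℝ) + 1) * L := by positivity
  rw [c3]
  field_simp
  ring

end Ray

/-! ## §4 The first-order term is additive and homogeneous in `A` -/

section Linear

variable [NormOneClass 𝔸]

/-- Two-parameter analyticity at the origin: `(s, t) ↦ Q(V₀, sA + tA′, c)` is analytic at `(0, 0)` (no smallness needed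
there: the field vanishes at the origin). [folklore] -/
theorem analyticAt_two_rays {L : ℕ} (hL : 1 ≤ L) {V₀ : B7Prop1Explicit.Site d → Fin d → 𝔸ˣ}
    (hV₀ : ∀ x κ, V₀ x κ ∈ U1 𝔸) (A A' : B7Prop1Explicit.Site d → Fin d → 𝔸) {α : ℝ}
    (q : B7Prop1Explicit.Site d) (κ : Fin d) (hα1 : α ≤ 1 / 64)
    (hreg : ∀ r : Fin d → Fin L, ‖((Wcx L V₀ q κ (boxVec L r) : 𝔸ˣ) : 𝔸) - 1‖ ≤ α) :
    AnalyticAt ℂ (fun p : ℂ × ℂ => mlog ((dbavgCov L V₀ (expCfg (p.1 • A + p.2 • A')) q κ : 𝔸ˣ) : 𝔸)) 0 := by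
  refine prop3_general_analyticAt_of_le_c3 (fun p : ℂ × ℂ => p.1 • A + p.2 • A') (fun x κ' => ?_) hL hV₀
    (a := 0) le_rfl (fun x κ' => by simp) (c3_nonneg d L) q κ hα1 hreg
  simp only [Pi.add_apply, Pi.smul_apply]
  exact ((ContinuousLinearMap.fst ℂ ℂ ℂ).analyticAt _).smul analyticAt_const |>.add
    (((ContinuousLinearMap.snd ℂ ℂ ℂ).analyticAt _).smul analyticAt_const)

omit [CompleteSpace 𝔸] [NormOneClass 𝔸] in
/-- chain rule along a line through the origin of `ℂ × ℂ`. [folklore] -/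
private theorem deriv_line {Φ : ℂ × ℂ → 𝔸} {D : ℂ × ℂ →L[ℂ] 𝔸} (hΦ : HasFDerivAt Φ D 0) (v : ℂ × ℂ) :
    deriv (fun s : ℂ => Φ (s • v)) 0 = D v := by
  have hl : HasDerivAt (fun s : ℂ => s • v) ((1 : ℂ) • v) 0 := (hasDerivAt_id (0 : ℂ)).smul_const v
  rw [one_smul] at hl
  exact (hΦ.comp_hasDerivAt_of_eq (0 : ℂ) hl (by rw [zero_smul])).deriv

/-- **«L(Q(V₀)A)_c» is additive in `A`**: the first-order Taylor term of the analytic `Q(V₀, ·, c)` is linear — here as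
additivity of the ray derivatives, from two-parameter analyticity at the origin. [folklore] -/
theorem ray_deriv_add {L : ℕ} (hL : 1 ≤ L) {V₀ : B7Prop1Explicit.Site d → Fin d → 𝔸ˣ}
    (hV₀ : ∀ x κ, V₀ x κ ∈ U1 𝔸) (A A' : B7Prop1Explicit.Site d → Fin d → 𝔸) {α : ℝ}
    (q : B7Prop1Explicit.Site d) (κ : Fin d) (hα1 : α ≤ 1 / 64)
    (hreg : ∀ r : Fin d → Fin L, ‖((Wcx L V₀ q κ (boxVec L r) : 𝔸ˣ) : 𝔸) - 1‖ ≤ α) :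
    deriv (fun t : ℂ => mlog ((dbavgCov L V₀ (expCfg (t • (A + A'))) q κ : 𝔸ˣ) : 𝔸)) 0
      = deriv (fun t : ℂ => mlog ((dbavgCov L V₀ (expCfg (t • A)) q κ : 𝔸ˣ) : 𝔸)) 0
        + deriv (fun t : ℂ => mlog ((dbavgCov L V₀ (expCfg (t • A')) q κ : 𝔸ˣ) : 𝔸)) 0 := by
  set Φ : ℂ × ℂ → 𝔸 := fun p => mlog ((dbavgCov L V₀ (expCfg (p.1 • A + p.2 • A')) q κ : 𝔸ˣ) : 𝔸) with hΦ
  have hF : HasFDerivAt Φ (fderiv ℂ Φ 0) 0 :=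
    (analyticAt_two_rays hL hV₀ A A' q κ hα1 hreg).differentiableAt.hasFDerivAt
  have e1 : (fun t : ℂ => mlog ((dbavgCov L V₀ (expCfg (t • (A + A'))) q κ : 𝔸ˣ) : 𝔸))
      = fun s : ℂ => Φ (s • ((1 : ℂ), (1 : ℂ))) := by
    funext s; simp only [hΦ, Prod.smul_mk, smul_eq_mul, mul_one, smul_add]
  have e2 : (fun t : ℂ => mlog ((dbavgCov L V₀ (expCfg (t • A)) q κ : 𝔸ˣ) : 𝔸))
      = fun s : ℂ => Φ (s • ((1 : ℂ), (0 : ℂ))) := by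
    funext s; simp only [hΦ, Prod.smul_mk, smul_eq_mul, mul_one, mul_zero, zero_smul, add_zero]
  have e3 : (fun t : ℂ => mlog ((dbavgCov L V₀ (expCfg (t • A')) q κ : 𝔸ˣ) : 𝔸))
      = fun s : ℂ => Φ (s • ((0 : ℂ), (1 : ℂ))) := by
    funext s; simp only [hΦ, Prod.smul_mk, smul_eq_mul, mul_one, mul_zero, zero_smul, zero_add]
  rw [e1, e2, e3, deriv_line hF, deriv_line hF, deriv_line hF, ← map_add, Prod.mk_add_mk, add_zero, zero_add]

/-- Along one ray through the origin: `t ↦ Q(V₀, tA, c)` is analytic at `t = 0` for EVERY field `A` (the field `0·A`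
vanishes). [folklore] -/
theorem analyticAt_ray_zero {L : ℕ} (hL : 1 ≤ L) {V₀ : B7Prop1Explicit.Site d → Fin d → 𝔸ˣ}
    (hV₀ : ∀ x κ, V₀ x κ ∈ U1 𝔸) (A : B7Prop1Explicit.Site d → Fin d → 𝔸) {α : ℝ}
    (q : B7Prop1Explicit.Site d) (κ : Fin d) (hα1 : α ≤ 1 / 64)
    (hreg : ∀ r : Fin d → Fin L, ‖((Wcx L V₀ q κ (boxVec L r) : 𝔸ˣ) : 𝔸) - 1‖ ≤ α) :
    AnalyticAt ℂ (fun t : ℂ => mlog ((dbavgCov L V₀ (expCfg (t • A)) q κ : 𝔸ˣ) : 𝔸)) 0 :=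
  prop3_general_analyticAt_of_le_c3 (fun t : ℂ => t • A)
    (fun x κ' => by simp only [Pi.smul_apply]; exact analyticAt_id.smul analyticAt_const)
    hL hV₀ (a := 0) le_rfl (fun x κ' => by simp) (c3_nonneg d L) q κ hα1 hreg

/-- **«L(Q(V₀)A)_c» is homogeneous in `A`** (over `ℂ`; chain rule along the ray). [folklore] -/
theorem ray_deriv_smul {L : ℕ} (hL : 1 ≤ L) {V₀ : B7Prop1Explicit.Site d → Fin d → 𝔸ˣ}
    (hV₀ : ∀ x κ, V₀ x κ ∈ U1 𝔸) (A : B7Prop1Explicit.Site d → Fin d → 𝔸) (c : ℂ) {α : ℝ}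
    (q : B7Prop1Explicit.Site d) (κ : Fin d) (hα1 : α ≤ 1 / 64)
    (hreg : ∀ r : Fin d → Fin L, ‖((Wcx L V₀ q κ (boxVec L r) : 𝔸ˣ) : 𝔸) - 1‖ ≤ α) :
    deriv (fun t : ℂ => mlog ((dbavgCov L V₀ (expCfg (t • (c • A))) q κ : 𝔸ˣ) : 𝔸)) 0
      = c • deriv (fun t : ℂ => mlog ((dbavgCov L V₀ (expCfg (t • A)) q κ : 𝔸ˣ) : 𝔸)) 0 := by
  set g : ℂ → 𝔸 := fun t => mlog ((dbavgCov L V₀ (expCfg (t • A)) q κ : 𝔸ˣ) : 𝔸) with hg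
  have hgd : HasDerivAt g (deriv g 0) (0 * c) := by
    rw [zero_mul]; exact (analyticAt_ray_zero hL hV₀ A q κ hα1 hreg).differentiableAt.hasDerivAt
  have hcomp := hgd.scomp (0 : ℂ) (hasDerivAt_mul_const c)
  have e : (fun t : ℂ => mlog ((dbavgCov L V₀ (expCfg (t • (c • A))) q κ : 𝔸ˣ) : 𝔸)) = g ∘ fun t : ℂ => t * c := by
    funext t; simp only [hg, Function.comp_apply, smul_smul]
  rw [e, hcomp.deriv]

end Linear

end Summit.QuantumFields.BalabanUV.T4Continuum.ShellMeasureAverageProp3Remainder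

end
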